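import Literature.Geometry.Kaehler.AnalyticSetIsolatingPlanes
import HarnessLib

/-!
# Quantitative transversality of isolating planes (towards Lelong's theorem)

A step in the proof of Lelong's theorem on the locally finite volume of analytic sets
([Chirka1989, §14.1 Thm.], `Literature/Geometry/Kaehler/HolomorphicChainFacts.lean`): the printed
proof uses, through Wirtinger's theorem, that the coordinate projections of one unitary
coordinate system dominate *uniformly* the volume of every complex `p`-plane. We replace this by
a finite family of linear projections `ℓ_j : E → ℂᵖ`, each proper on the analytic set near the
base point (its kernel is an *isolating plane*, [Chirka1989, §3.4 Lemma 1, §3.5]), which is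
**uniformly coercive on all `p`-planes**: there is `c₀ > 0` such that every `p`-dimensional
subspace `T` is mapped by some `ℓ_j` with `c₀ ‖v‖ ≤ ‖ℓ_j v‖` on `T`.

* `Literature.Geometry.Kaehler.SCV.exists_proj_ker_eq_range` — a linear surjection `E → ℂᵖ`
  with prescribed kernel `range ι` (`ι : ℂ^{n-p} → E` injective);
* `Literature.Geometry.Kaehler.SCV.coercive_of_norm_sub_lt` — coercivity is open in the
  operator norm;
* `Literature.Geometry.Kaehler.SCV.exists_finset_isolating_coercive` — the quantitative form of
  `Literature.Geometry.Kaehler.SCV.exists_finset_isolating`: compactness of the orthonormal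
  `p`-frames of an auxiliary Euclidean structure, openness of coercivity in the operator norm.

## References

* E. M. Chirka, *Complex Analytic Sets*, Kluwer 1989, §3.4 Lemma 1–2, §3.5, §14.1 [Chirka1989].
-/

open Metric Set Filter Function
open scoped Topology

namespace Literature.Geometry.Kaehler

namespace SCV

section Main

variable {E : Type*} [NormedAddCommGroup E] [NormedSpace ℂ E] [FiniteDimensional ℂ E]

/-- **A linear surjection with prescribed kernel.** For an injective linear `ι : ℂᵏ → E` and
`k + p = dim E` there is a continuous linear surjection `ℓ : E → ℂᵖ` with `ker ℓ = range ι`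
(project onto a complement of `range ι` and identify it with `ℂᵖ`). [folklore] -/
theorem exists_proj_ker_eq_range {k p : ℕ} (ι : (Fin k → ℂ) →L[ℂ] E) (hι : Injective ι)
    (hkp : k + p = Module.finrank ℂ E) :
    ∃ ℓ : E →L[ℂ] (Fin p → ℂ), Surjective ℓ ∧
      LinearMap.ker (ℓ : E →ₗ[ℂ] (Fin p → ℂ)) = LinearMap.range (ι : (Fin k → ℂ) →ₗ[ℂ] E) := by
  set L : Submodule ℂ E := LinearMap.range (ι : (Fin k → ℂ) →ₗ[ℂ] E) with hL
  obtain ⟨K, hLK⟩ := L.exists_isCompl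
  have hLdim : Module.finrank ℂ L = k := by
    rw [hL, LinearMap.finrank_range_of_inj hι]; simp
  have hKdim : Module.finrank ℂ K = Module.finrank ℂ (Fin p → ℂ) := by
    have h1 := Submodule.finrank_sup_add_finrank_inf_eq L K
    rw [hLK.sup_eq_top, hLK.inf_eq_bot, finrank_top, finrank_bot, add_zero] at h1
    simp only [Module.finrank_fin_fun]
    omega
  set κ : K ≃ₗ[ℂ] (Fin p → ℂ) := LinearEquiv.ofFinrankEq K _ hKdim with hκ
  set P : E →ₗ[ℂ] K := Submodule.projectionOnto K L hLK.symm with hP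
  refine ⟨LinearMap.toContinuousLinearMap ((κ : K →ₗ[ℂ] (Fin p → ℂ)) ∘ₗ P), ?_, ?_⟩
  · intro w
    obtain ⟨v, hv⟩ := Submodule.projectionOnto_surjective hLK.symm (κ.symm w)
    refine ⟨v, ?_⟩
    simp only [LinearMap.coe_toContinuousLinearMap', LinearMap.coe_comp, LinearEquiv.coe_coe,
      Function.comp_apply]
    rw [show P v = κ.symm w from hv, LinearEquiv.apply_symm_apply]
  · ext v
    simp only [LinearMap.mem_ker, ContinuousLinearMap.coe_coe,
      LinearMap.coe_toContinuousLinearMap', LinearMap.coe_comp, LinearEquiv.coe_coe,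
      Function.comp_apply, map_eq_zero_iff κ κ.injective]
    rw [← LinearMap.mem_ker, hP, Submodule.ker_projectionOnto]

/-- Coercivity is stable under small perturbations in operator norm: if `‖M a‖ ≥ 2c‖a‖` for all
`a` and `‖M' - M‖ < c` (`c ≥ 0`), then `‖M' a‖ ≥ c‖a‖`. [folklore] -/
theorem coercive_of_norm_sub_lt {X Y : Type*} [NormedAddCommGroup X] [NormedSpace ℂ X]
    [NormedAddCommGroup Y] [NormedSpace ℂ Y] {M M' : X →L[ℂ] Y} {c : ℝ}
    (hM : ∀ a, 2 * c * ‖a‖ ≤ ‖M a‖) (hMM' : ‖M' - M‖ ≤ c) (a : X) : c * ‖a‖ ≤ ‖M' a‖ := by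
  have h1 : ‖(M' - M) a‖ ≤ c * ‖a‖ :=
    ((M' - M).le_opNorm a).trans (mul_le_mul_of_nonneg_right hMM' (norm_nonneg a))
  have h2 : ‖M a‖ ≤ ‖M' a‖ + ‖(M' - M) a‖ := by
    have : M a = M' a - (M' - M) a := by simp
    rw [this]
    exact norm_sub_le _ _
  linarith [hM a]

/-- **Finitely many isolating planes, uniformly transverse to all `p`-planes.** Let `A ∋ a` be
cut out by holomorphic equations near `a`, with all regular points of `A` near `a` of
codimension `≥ dim E - p` ("`dim_a A ≤ p`"), `p ≤ dim E`. Then there are finitely many pairs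
`(ι_j, ℓ_j)` — `ι_j : ℂ^{n-p} → E` injective with `a` isolated in `A ∩ (a + range ι_j)`
(an isolating plane, [Chirka1989, §3.5]) and `ℓ_j : E → ℂᵖ` a linear surjection with kernel
`range ι_j` — and a constant `c₀ > 0` such that **every** `p`-dimensional subspace `T` of `E` is
mapped `c₀`-coercively by some `ℓ_j`: `c₀ ‖v‖ ≤ ‖ℓ_j v‖` for `v ∈ T`. (For each orthonormal
`p`-frame of an auxiliary Euclidean structure take an isolating plane transverse to its span,
`exists_isolating_plane`; coercivity of the corresponding projection on nearby frames is an open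
condition; the orthonormal frames form a compact set.) This is the quantitative substitute, in
our proof of [Chirka1989, §14.1 Thm.], for the unitary coordinates of [Chirka1989, §3.4 Lemma 2].
[cite: Chirka1989, §3.4 Lemma 2 and §14.1] -/
theorem exists_finset_isolating_coercive {A : Set E} {a : E} {p : ℕ}
    (hA : Literature.Analysis.Complex.SCV.IsZeroSetAt A a) (haA : a ∈ A)
    (hdim : ∀ᶠ x in 𝓝 a, x ∈ A → ∀ q, IsRegPt A q x → Module.finrank ℂ E ≤ q + p)
    (hp : p ≤ Module.finrank ℂ E) :
    ∃ (k : ℕ) (ι : Fin k → (Fin (Module.finrank ℂ E - p) → ℂ) →L[ℂ] E)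
      (ℓ : Fin k → E →L[ℂ] (Fin p → ℂ)) (c₀ : ℝ), 0 < c₀ ∧
      (∀ j, Injective (ι j) ∧
        (∀ᶠ w in 𝓝[≠] (0 : Fin (Module.finrank ℂ E - p) → ℂ), a + ι j w ∉ A) ∧
        Surjective (ℓ j) ∧
        LinearMap.ker (ℓ j : E →ₗ[ℂ] (Fin p → ℂ)) =
          LinearMap.range (ι j : (Fin (Module.finrank ℂ E - p) → ℂ) →ₗ[ℂ] E)) ∧
      ∀ T : Submodule ℂ E, Module.finrank ℂ T = p →
        ∃ j, ∀ v ∈ T, c₀ * ‖v‖ ≤ ‖ℓ j v‖ := by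
  classical
  set n := Module.finrank ℂ E with hn
  -- an auxiliary Euclidean structure
  set Euc := EuclideanSpace ℂ (Fin n)
  have hfinE : Module.finrank ℂ E = Module.finrank ℂ Euc := by
    rw [finrank_euclideanSpace_fin]
  set φ : E ≃L[ℂ] Euc := ContinuousLinearEquiv.ofFinrankEq hfinE with hφ
  -- the frame maps `a ↦ Σ aᵢ tᵢ` on `EuclideanSpace ℂ (Fin p)`, continuous in the frame `t`
  set fm : (Fin p → Euc) → (EuclideanSpace ℂ (Fin p) →L[ℂ] Euc) := fun t =>
    ∑ i, (EuclideanSpace.proj i : EuclideanSpace ℂ (Fin p) →L[ℂ] ℂ).smulRight (t i) with hfm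
  have hfm_apply : ∀ t a, fm t a = ∑ i, a i • t i := fun t a => by simp [hfm]
  have hfm_cont : Continuous fm := by
    rw [hfm]
    refine continuous_finsetSum _ fun i _ => ?_
    exact (ContinuousLinearMap.smulRightL ℂ (EuclideanSpace ℂ (Fin p)) Euc
      (EuclideanSpace.proj i)).continuous.comp (continuous_apply i)
  have hfm_norm : ∀ t, Orthonormal ℂ t → ∀ a, ‖fm t a‖ = ‖a‖ := by
    intro t ht a
    rw [hfm_apply]
    have hsq : ‖∑ i, a i • t i‖ ^ 2 = ‖a‖ ^ 2 := by
      rw [@norm_sq_eq_re_inner ℂ, ht.inner_sum, EuclideanSpace.norm_sq_eq]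
      rw [map_sum]
      refine Finset.sum_congr rfl fun i _ => ?_
      rw [RCLike.conj_mul, ← RCLike.ofReal_pow, RCLike.ofReal_re]
    have h1 : 0 ≤ ‖∑ i, a i • t i‖ := norm_nonneg _
    have h2 : 0 ≤ ‖a‖ := norm_nonneg _
    nlinarith [hsq, h1, h2, sq_nonneg (‖∑ i, a i • t i‖ - ‖a‖)]
  -- for every `p`-frame, an isolating plane transverse to its span, and a projection along it
  have hspan : ∀ t : Fin p → Euc,
      Module.finrank ℂ (Submodule.span ℂ (Set.range (φ.symm ∘ t))) ≤ p := fun t => by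
    have := finrank_range_le_card (R := ℂ) (φ.symm ∘ t)
    rw [Fintype.card_fin] at this
    exact this
  choose ιf hιinj hιT hιiso using fun t : Fin p → Euc =>
    exists_isolating_plane hA haA hdim (Submodule.span ℂ (Set.range (φ.symm ∘ t))) (hspan t) hp
  have hkp : (n - p) + p = Module.finrank ℂ E := by rw [← hn]; omega
  choose ℓf hℓsurj hℓker using fun t : Fin p → Euc =>
    exists_proj_ker_eq_range (ιf t) (hιinj t) hkp
  -- the family of linear maps `a ↦ ℓ_{t₀} (φ⁻¹ (Σ aᵢ tᵢ))`
  set M : (Fin p → Euc) → (Fin p → Euc) → (EuclideanSpace ℂ (Fin p) →L[ℂ] (Fin p → ℂ)) :=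
    fun t₀ t => (ℓf t₀).comp ((φ.symm : Euc →L[ℂ] E).comp (fm t)) with hM
  have hMapply : ∀ t₀ t a, M t₀ t a = ℓf t₀ (φ.symm (fm t a)) := fun _ _ _ => rfl
  have hMcont : ∀ t₀, Continuous (M t₀) := fun t₀ =>
    continuous_const.clm_comp (continuous_const.clm_comp hfm_cont)
  -- `M t₀ t₀` is injective for an orthonormal `t₀`, hence coercive
  have hcoer : ∀ t₀ : Fin p → Euc, Orthonormal ℂ t₀ →
      ∃ c : ℝ, 0 < c ∧ ∀ a, 2 * c * ‖a‖ ≤ ‖M t₀ t₀ a‖ := by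
    intro t₀ ht₀
    have hinj : LinearMap.ker (M t₀ t₀ : EuclideanSpace ℂ (Fin p) →ₗ[ℂ] (Fin p → ℂ)) = ⊥ := by
      rw [LinearMap.ker_eq_bot']
      intro a ha
      have h1 : φ.symm (fm t₀ a) ∈
          LinearMap.ker (ℓf t₀ : E →ₗ[ℂ] (Fin p → ℂ)) := by
        rw [LinearMap.mem_ker]; exact ha
      rw [hℓker t₀] at h1
      have h2 : φ.symm (fm t₀ a) ∈ Submodule.span ℂ (Set.range (φ.symm ∘ t₀)) := by
        rw [hfm_apply, map_sum]
        refine Submodule.sum_mem _ fun i _ => ?_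
        rw [map_smul]
        exact Submodule.smul_mem _ _ (Submodule.subset_span ⟨i, rfl⟩)
      have h3 : φ.symm (fm t₀ a) ∈ LinearMap.range (ιf t₀ :
          (Fin (n - p) → ℂ) →ₗ[ℂ] E) ⊓ Submodule.span ℂ (Set.range (φ.symm ∘ t₀)) := ⟨h1, h2⟩
      rw [hιT t₀, Submodule.mem_bot, map_eq_zero_iff _ φ.symm.injective] at h3
      have h4 : ‖a‖ = 0 := by rw [← hfm_norm t₀ ht₀ a, h3, norm_zero]
      exact norm_eq_zero.1 h4
    obtain ⟨K, hK, hanti⟩ := LinearMap.exists_antilipschitzWith _ hinj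
    refine ⟨(2 * K)⁻¹, by positivity, fun a => ?_⟩
    have h := hanti.le_mul_dist a 0
    simp only [dist_zero_right, map_zero, ContinuousLinearMap.coe_coe] at h
    have hK' : (0 : ℝ) < K := hK
    calc 2 * (2 * (K : ℝ))⁻¹ * ‖a‖ = (K : ℝ)⁻¹ * ‖a‖ := by ring
      _ ≤ (K : ℝ)⁻¹ * (K * ‖M t₀ t₀ a‖) := by gcongr
      _ = ‖M t₀ t₀ a‖ := by field_simp
  choose! cf hcpos hcf using hcoer
  -- the open sets of frames on which `ℓ_{t₀}` stays coercive
  set O : (Fin p → Euc) → Set (Fin p → Euc) := fun t₀ => {t | ‖M t₀ t - M t₀ t₀‖ < cf t₀}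
    with hO
  have hOo : ∀ t₀, IsOpen (O t₀) := fun t₀ =>
    isOpen_lt ((hMcont t₀).sub continuous_const).norm continuous_const
  have hmemO : ∀ t₀, Orthonormal ℂ t₀ → t₀ ∈ O t₀ := fun t₀ ht₀ => by
    show ‖M t₀ t₀ - M t₀ t₀‖ < cf t₀
    rw [sub_self, norm_zero]; exact hcpos t₀ ht₀
  -- compactness of the set of orthonormal frames
  set Fr : Set (Fin p → Euc) := {t | Orthonormal ℂ t} with hFr
  have hFrc : IsCompact Fr := by
    refine Metric.isCompact_of_isClosed_isBounded ?_ ?_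
    · have : Fr = ⋂ i : Fin p, ⋂ j : Fin p,
          {t : Fin p → Euc | inner ℂ (t i) (t j) = if i = j then (1 : ℂ) else 0} := by
        ext t
        simp only [hFr, Set.mem_setOf_eq, orthonormal_iff_ite, Set.mem_iInter]
      rw [this]
      refine isClosed_iInter fun i => isClosed_iInter fun j => ?_
      exact isClosed_eq ((continuous_apply i).inner (continuous_apply j)) continuous_const
    · refine (Metric.isBounded_closedBall (x := (0 : Fin p → Euc)) (r := 1)).subset fun t ht => ?_
      rw [mem_closedBall, dist_zero_right, pi_norm_le_iff_of_nonneg zero_le_one]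
      intro i
      rw [ht.norm_eq_one i]
  obtain ⟨S, hS⟩ := hFrc.elim_finite_subcover (fun t₀ : Fr => O t₀) (fun t₀ => hOo t₀)
    fun t ht => Set.mem_iUnion.2 ⟨⟨t, ht⟩, hmemO t ht⟩
  -- the constant
  set Cφ : ℝ := max ‖(φ.symm : Euc →L[ℂ] E)‖ 1 with hCφ
  have hCφpos : 0 < Cφ := lt_of_lt_of_le one_pos (le_max_right _ _)
  have hnormv : ∀ v : E, ‖v‖ ≤ Cφ * ‖φ v‖ := fun v => by
    calc ‖v‖ = ‖φ.symm (φ v)‖ := by rw [φ.symm_apply_apply]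
      _ ≤ ‖(φ.symm : Euc →L[ℂ] E)‖ * ‖φ v‖ := (φ.symm : Euc →L[ℂ] E).le_opNorm _
      _ ≤ Cφ * ‖φ v‖ := by gcongr; exact le_max_left _ _
  set c₁ : ℝ := if hSne : S.Nonempty then S.inf' hSne (fun t₀ => cf t₀) else 1 with hc₁
  have hc₁pos : 0 < c₁ := by
    rw [hc₁]
    split_ifs with hSne
    · obtain ⟨t₀, ht₀S, ht₀⟩ := S.exists_mem_eq_inf' hSne (fun t₀ => cf t₀)
      rw [ht₀]; exact hcpos t₀ t₀.2
    · exact one_pos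
  have hc₁le : ∀ t₀ ∈ S, c₁ ≤ cf t₀ := fun t₀ ht₀ => by
    rw [hc₁, dif_pos ⟨t₀, ht₀⟩]
    exact Finset.inf'_le _ ht₀
  -- enumerate the finite set
  set k := S.card with hk
  set en : Fin k → Fr := fun j => (S.equivFin.symm j : Fr)
  refine ⟨k, fun j => ιf (en j), fun j => ℓf (en j), c₁ / Cφ, div_pos hc₁pos hCφpos,
    fun j => ⟨hιinj _, hιiso _, hℓsurj _, hℓker _⟩, fun T hT => ?_⟩
  -- an orthonormal frame of `φ '' T`
  set T' : Submodule ℂ Euc := T.map (φ.toLinearEquiv : E →ₗ[ℂ] Euc) with hT'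
  have hT'dim : Module.finrank ℂ T' = p := by
    rw [hT', LinearEquiv.finrank_map_eq]; exact hT
  obtain ⟨b⟩ : Nonempty (OrthonormalBasis (Fin p) ℂ T') :=
    ⟨(stdOrthonormalBasis ℂ T').reindex (finCongr hT'dim)⟩
  set t : Fin p → Euc := fun i => (b i : Euc) with ht
  have htO : Orthonormal ℂ t := b.orthonormal.comp_linearIsometry T'.subtypeₗᵢ
  obtain ⟨t₀, ht₀S, ht₀⟩ := Set.mem_iUnion₂.1 (hS htO)
  refine ⟨S.equivFin ⟨t₀, ht₀S⟩, fun v hv => ?_⟩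
  have hen : en (S.equivFin ⟨t₀, ht₀S⟩) = t₀ := by
    simp [en]
  show c₁ / Cφ * ‖v‖ ≤ ‖ℓf (en (S.equivFin ⟨t₀, ht₀S⟩)) v‖
  rw [hen]
  -- coordinates of `φ v` in the basis `b`
  have hvT' : φ v ∈ T' := Submodule.mem_map_of_mem hv
  set a : EuclideanSpace ℂ (Fin p) := b.repr ⟨φ v, hvT'⟩ with ha
  have hsum : fm t a = φ v := by
    rw [hfm_apply]
    have h1 := b.sum_repr ⟨φ v, hvT'⟩
    have h2 := congrArg (fun x : T' => (x : Euc)) h1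
    simp only [Submodule.coe_sum, Submodule.coe_smul] at h2
    exact h2
  have hnorma : ‖a‖ = ‖φ v‖ := by
    rw [ha, LinearIsometryEquiv.norm_map]; rfl
  -- coercivity of `M t₀ t` on the coordinates
  have hMt : c₁ * ‖a‖ ≤ ‖M t₀ t a‖ := by
    have h := coercive_of_norm_sub_lt (hcf t₀ t₀.2) (le_of_lt ht₀) a
    exact le_trans (mul_le_mul_of_nonneg_right (hc₁le t₀ ht₀S) (norm_nonneg a)) h
  rw [hMapply, hsum, φ.symm_apply_apply] at hMt
  calc c₁ / Cφ * ‖v‖ ≤ c₁ / Cφ * (Cφ * ‖φ v‖) :=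
        mul_le_mul_of_nonneg_left (hnormv v) (div_pos hc₁pos hCφpos).le
    _ = c₁ * ‖φ v‖ := by field_simp
    _ = c₁ * ‖a‖ := by rw [hnorma]
    _ ≤ ‖ℓf t₀ v‖ := hMt

end Main

end SCV

end Literature.Geometry.Kaehler
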